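import Summits.QuantumFields.BalabanUV.T4Continuum.Support.DirichletCornerCutoffH2Local

/-!
# T⁴ programme, spine node NE2 (U1a), sub-row Δ1 «NE2⁰-Dirichlet» — THE WEIGHTED DIAGONAL HESSIAN OF A SUPPORTED FIELD UNDER A
# FINITE FAMILY OF CORNER-KILLING CUTOFFS (route r5, file F-W3: the dyadic assembly, abstract form)

NE2 formalisation swarm `b2b-balaban-t4-ne2-formalise-*`, LEAF PROVER 09 (gen 10), brick of the threshold-free route r5 (memo
`t4/T4-EST-NE2-D1-CORNER.md` §4 (W-H); journal `HOME/CLAIMS.log` 2026-08-21 l.24724 / l.25057).  `DirichletCornerCutoffH2Local.weighted_hdiag_le_local`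
(p244390) bounds `Σ_μ Σ_Ω φ²|P_μ z|²` for ONE real cutoff `φ` killing the `Ω`-neighbours of the corner sites, with remainders LOCAL to the
transition layer of `φ` (position-dependent difference bounds `g`, `h`).  Route r5 needs the `dist^p`-WEIGHTED diagonal Hessian, obtained from a
DYADIC FAMILY `φ_R` (`R = 2^i`) with weights `w_R = (2R)^p`; THIS FILE is the assembly step, stated for an ARBITRARY finite family so that the
geometric construction of the `φ_R` (file F-W2, `DirichletCornerCutoffFamily`, not yet written) only has to deliver the per-cutoff hypotheses:
 * **`weighted_hdiag_le_family`**: for a finite family `(φ_i, g_i, h_i)_{i ∈ s}` of corner-killing cutoffs with local difference bounds and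
   weights `w_i ≥ 0`,
   `Σ_μ Σ_Ω (Σ_i w_i φ_i²)|P_μ z|² ≤ 8Σ_Ω (Σ_i w_i φ_i²)|Δz|² + (24d+4)‖c‖²Σ_μ Σ_x (Σ_i w_i (g_i(x)² + g_i(x+e_μ)²))|∂_μ z|² + (24d²+4d)‖c‖⁴Σ_Ω (Σ_i w_i h_i²)|z|²`;
 * **`weighted_hdiag_le_of_minorant`**: hence for any weight `W ≤ Σ_i w_i φ_i²` on `Ω` (e.g. `W = dist(·, corner set)^p` under a dyadic family)
   the `W`-weighted diagonal Hessian obeys the same bound.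
Pure bookkeeping (linearity of p244390 in the weight); no geometry, no estimate of the three right-hand weights — those are F-W2/F-W4's.

HONEST FRAMING (T4-DAG p. 1).  [folklore] finite sums of a landed inequality; nothing about [B9]'s printed regions; `hinjK` ∕ W3 off boxes OPEN;
Δ1 NOT closed; NE2 (U1a) NOT proved; spine PROVED 0/9 unchanged; NOT infinite volume, NOT a mass gap, NOT the Clay problem.  HONEST DEPENDENCY:
continuum YM on T⁴ ⇐ BetaPertH ∧ nine spine estimates (0/9 proved); BetaPertH ⇐ (D1) ∧ (D4) ∧ CAP+tail; G-an2-4 gates asym, D1 and NE2/3/4.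
No `sorry`.
-/

noncomputable section

open scoped BigOperators ComplexConjugate Matrix
open Finset

namespace Summit.QuantumFields.BalabanUV.T4Continuum.DirichletWeightedHessian

open Literature.MathematicalPhysics.QuantumFieldTheory.Balaban1983to89.B5Prop11Plancherel (Tor unitVec)
open Literature.MathematicalPhysics.QuantumFieldTheory.Balaban1983to89.B5Action121 (sdiff LapS)
open Summit.QuantumFields.BalabanUV.T4Continuum
open Summit.QuantumFields.BalabanUV.Beta.GAN24.DirichletBoxRegularity (Pdir SuppIn)
open Summit.QuantumFields.BalabanUV.T4Continuum.DirichletCornerRegularity (cornerSites)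
open Summit.QuantumFields.BalabanUV.T4Continuum.DirichletCornerCutoffH2Local (weighted_hdiag_le_local)

variable {d : ℕ} {N : Fin d → ℕ} [hN : ∀ μ, NeZero (N μ)]

/-! ## §1 Rebracketing finite families of weights -/

omit hN in
/-- `Σ_{x∈B} (Σ_i w_i a_i(x))·Q(x) = Σ_i w_i Σ_{x∈B} a_i(x)·Q(x)`. [folklore] -/
theorem sum_family_mul {ι : Type*} (s : Finset ι) (B : Finset (Tor N)) (w : ι → ℝ) (a : ι → Tor N → ℝ) (Q : Tor N → ℝ) :
    ∑ x ∈ B, (∑ i ∈ s, w i * a i x) * Q x = ∑ i ∈ s, w i * ∑ x ∈ B, a i x * Q x := by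
  simp only [Finset.sum_mul, Finset.mul_sum, mul_assoc]
  exact Finset.sum_comm

omit hN in
/-- `Σ_μ Σ_{x∈B} (Σ_i w_i a_i(μ,x))·Q(μ,x) = Σ_i w_i Σ_μ Σ_{x∈B} a_i(μ,x)·Q(μ,x)`. [folklore] -/
theorem sum_sum_family_mul {ι : Type*} (s : Finset ι) (B : Finset (Tor N)) (w : ι → ℝ) (a : ι → Fin d → Tor N → ℝ)
    (Q : Fin d → Tor N → ℝ) :
    ∑ μ, ∑ x ∈ B, (∑ i ∈ s, w i * a i μ x) * Q μ x = ∑ i ∈ s, w i * ∑ μ, ∑ x ∈ B, a i μ x * Q μ x := by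
  calc ∑ μ, ∑ x ∈ B, (∑ i ∈ s, w i * a i μ x) * Q μ x = ∑ μ, ∑ i ∈ s, w i * ∑ x ∈ B, a i μ x * Q μ x :=
        Finset.sum_congr rfl fun μ _ => sum_family_mul s B w (fun i => a i μ) (Q μ)
    _ = ∑ i ∈ s, ∑ μ, w i * ∑ x ∈ B, a i μ x * Q μ x := Finset.sum_comm
    _ = ∑ i ∈ s, w i * ∑ μ, ∑ x ∈ B, a i μ x * Q μ x := Finset.sum_congr rfl fun i _ => by rw [Finset.mul_sum]

/-! ## §2 The family form of the corner-cutoff `H²` bound -/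

section Family

variable (c : ℂ) (Ω : Finset (Tor N)) (z : Tor N → ℂ) {ι : Type*} (s : Finset ι) {φ g h : ι → Tor N → ℝ} {w : ι → ℝ}

/-- **THE WEIGHTED DIAGONAL HESSIAN UNDER A FINITE FAMILY OF CORNER-KILLING CUTOFFS**: weights `w_i ≥ 0`, each `φ_i` with local
difference bounds `g_i`, `h_i` and vanishing on the `Ω`-neighbours of the corner sites; `z` supported in `Ω`; no shape hypothesis. [folklore] -/
theorem weighted_hdiag_le_family (hz : SuppIn N Ω z) (hw : ∀ i ∈ s, 0 ≤ w i)
    (hg : ∀ i ∈ s, ∀ y ν, |φ i (y + unitVec N ν) - φ i y| ≤ g i y ∧ |φ i (y - unitVec N ν) - φ i y| ≤ g i y)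
    (hh : ∀ i ∈ s, ∀ y ν, |φ i (y + unitVec N ν) + φ i (y - unitVec N ν) - 2 * φ i y| ≤ h i y)
    (hcorner : ∀ i ∈ s, ∀ x ∈ cornerSites Ω, ∀ μ,
      (x + unitVec N μ ∈ Ω → φ i (x + unitVec N μ) = 0) ∧ (x - unitVec N μ ∈ Ω → φ i (x - unitVec N μ) = 0)) :
    ∑ μ, ∑ x ∈ Ω, (∑ i ∈ s, w i * φ i x ^ 2) * ‖(Pdir N c μ *ᵥ z) x‖ ^ 2
      ≤ 8 * ∑ x ∈ Ω, (∑ i ∈ s, w i * φ i x ^ 2) * ‖(LapS N c *ᵥ z) x‖ ^ 2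
        + (24 * d + 4) * ‖c‖ ^ 2
            * ∑ μ, ∑ x, (∑ i ∈ s, w i * (g i x ^ 2 + g i (x + unitVec N μ) ^ 2)) * ‖(sdiff N c μ *ᵥ z) x‖ ^ 2
        + (24 * (d : ℝ) ^ 2 + 4 * d) * (‖c‖ ^ 2) ^ 2 * ∑ x ∈ Ω, (∑ i ∈ s, w i * h i x ^ 2) * ‖z x‖ ^ 2 := by
  -- each cutoff separately, times its weight
  have key : ∀ i ∈ s, w i * (∑ μ, ∑ x ∈ Ω, φ i x ^ 2 * ‖(Pdir N c μ *ᵥ z) x‖ ^ 2)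
      ≤ w i * (8 * ∑ x ∈ Ω, φ i x ^ 2 * ‖(LapS N c *ᵥ z) x‖ ^ 2
          + (24 * d + 4) * ‖c‖ ^ 2 * ∑ μ, ∑ x, (g i x ^ 2 + g i (x + unitVec N μ) ^ 2) * ‖(sdiff N c μ *ᵥ z) x‖ ^ 2
          + (24 * (d : ℝ) ^ 2 + 4 * d) * (‖c‖ ^ 2) ^ 2 * ∑ x ∈ Ω, h i x ^ 2 * ‖z x‖ ^ 2) :=
    fun i hi => mul_le_mul_of_nonneg_left (weighted_hdiag_le_local c Ω z hz (hg i hi) (hh i hi) (hcorner i hi)) (hw i hi)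
  have hsum := Finset.sum_le_sum key
  -- rebracket the left-hand side
  have eL : ∑ μ, ∑ x ∈ Ω, (∑ i ∈ s, w i * φ i x ^ 2) * ‖(Pdir N c μ *ᵥ z) x‖ ^ 2
      = ∑ i ∈ s, w i * ∑ μ, ∑ x ∈ Ω, φ i x ^ 2 * ‖(Pdir N c μ *ᵥ z) x‖ ^ 2 :=
    sum_sum_family_mul s Ω w (fun i _ x => φ i x ^ 2) fun μ x => ‖(Pdir N c μ *ᵥ z) x‖ ^ 2
  -- rebracket the three right-hand terms
  have eΔ : ∑ x ∈ Ω, (∑ i ∈ s, w i * φ i x ^ 2) * ‖(LapS N c *ᵥ z) x‖ ^ 2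
      = ∑ i ∈ s, w i * ∑ x ∈ Ω, φ i x ^ 2 * ‖(LapS N c *ᵥ z) x‖ ^ 2 :=
    sum_family_mul s Ω w (fun i x => φ i x ^ 2) fun x => ‖(LapS N c *ᵥ z) x‖ ^ 2
  have eG : ∑ μ, ∑ x, (∑ i ∈ s, w i * (g i x ^ 2 + g i (x + unitVec N μ) ^ 2)) * ‖(sdiff N c μ *ᵥ z) x‖ ^ 2
      = ∑ i ∈ s, w i * ∑ μ, ∑ x, (g i x ^ 2 + g i (x + unitVec N μ) ^ 2) * ‖(sdiff N c μ *ᵥ z) x‖ ^ 2 :=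
    sum_sum_family_mul s univ w (fun i μ x => g i x ^ 2 + g i (x + unitVec N μ) ^ 2) fun μ x => ‖(sdiff N c μ *ᵥ z) x‖ ^ 2
  have eH : ∑ x ∈ Ω, (∑ i ∈ s, w i * h i x ^ 2) * ‖z x‖ ^ 2 = ∑ i ∈ s, w i * ∑ x ∈ Ω, h i x ^ 2 * ‖z x‖ ^ 2 :=
    sum_family_mul s Ω w (fun i x => h i x ^ 2) fun x => ‖z x‖ ^ 2
  rw [eL, eΔ, eG, eH, Finset.mul_sum, Finset.mul_sum, Finset.mul_sum, ← Finset.sum_add_distrib, ← Finset.sum_add_distrib]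
  refine hsum.trans (le_of_eq (Finset.sum_congr rfl fun i _ => by ring))

/-- **… FOR ANY WEIGHT BELOW THE FAMILY** (`0 ≤ W ≤ Σ_i w_i φ_i²` on `Ω`, e.g. `dist(·, corners)^p` under a dyadic family): the `W`-weighted
diagonal Hessian obeys the family bound. [folklore] -/
theorem weighted_hdiag_le_of_minorant (hz : SuppIn N Ω z) (hw : ∀ i ∈ s, 0 ≤ w i)
    (hg : ∀ i ∈ s, ∀ y ν, |φ i (y + unitVec N ν) - φ i y| ≤ g i y ∧ |φ i (y - unitVec N ν) - φ i y| ≤ g i y)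
    (hh : ∀ i ∈ s, ∀ y ν, |φ i (y + unitVec N ν) + φ i (y - unitVec N ν) - 2 * φ i y| ≤ h i y)
    (hcorner : ∀ i ∈ s, ∀ x ∈ cornerSites Ω, ∀ μ,
      (x + unitVec N μ ∈ Ω → φ i (x + unitVec N μ) = 0) ∧ (x - unitVec N μ ∈ Ω → φ i (x - unitVec N μ) = 0))
    {W : Tor N → ℝ} (hW : ∀ x ∈ Ω, W x ≤ ∑ i ∈ s, w i * φ i x ^ 2) :
    ∑ μ, ∑ x ∈ Ω, W x * ‖(Pdir N c μ *ᵥ z) x‖ ^ 2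
      ≤ 8 * ∑ x ∈ Ω, (∑ i ∈ s, w i * φ i x ^ 2) * ‖(LapS N c *ᵥ z) x‖ ^ 2
        + (24 * d + 4) * ‖c‖ ^ 2
            * ∑ μ, ∑ x, (∑ i ∈ s, w i * (g i x ^ 2 + g i (x + unitVec N μ) ^ 2)) * ‖(sdiff N c μ *ᵥ z) x‖ ^ 2
        + (24 * (d : ℝ) ^ 2 + 4 * d) * (‖c‖ ^ 2) ^ 2 * ∑ x ∈ Ω, (∑ i ∈ s, w i * h i x ^ 2) * ‖z x‖ ^ 2 := by
  refine le_trans ?_ (weighted_hdiag_le_family c Ω z s hz hw hg hh hcorner)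
  exact Finset.sum_le_sum fun μ _ => Finset.sum_le_sum fun x hx => mul_le_mul_of_nonneg_right (hW x hx) (by positivity)

end Family

end Summit.QuantumFields.BalabanUV.T4Continuum.DirichletWeightedHessian

end
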